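import Mathlib
import Literature.NumberTheory.Sieve.BombieriVinogradovFacts

/-!
# Top-window purity from the window moment bound (stub `stub_purity_of_windowMoment` of line
`upward-replication-free-factorability`, crux `EH`)

The Markov (Chebyshev-inequality) step of the line.  Write `M = x^{1−ε'}`, `L = log x`,
`D = ⌊x^{1/2−δ₀}⌋`, and for a modulus `m` let
`E♯(x; m) = max_{a unit mod m} ‖φ(m)⁻¹ ∑_{χ mod m, cond χ > D} χ(a⁻¹) ψ(x, χ)‖`
(`ψ(x, χ) = Literature.NumberTheory.Sieve.chebyshevPsiChar χ x`) be the maximal conductor-excised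
discrepancy.  The hypothesis (the window moment bound, stub `stub_windowMoment` of the line, taken
VERBATIM as a hypothesis — this file is an implication and asserts nothing about it) provides, for
every window exponent `0 < ε' ≤ 1/2`, data `δ₀ ∈ (0, 1/2)`, `k : ℕ`, `η > 0`, `x₀` and, for every
`x ≥ x₀`, an exceptional set `E` with `#E ≤ x^{1−ε'−η}` and
`∑_{m ∈ (M, 2M] \ E} E♯(x; m)^{2k} ≤ x^{2k−η} / M^{2k−1}`.
The conclusion is top-window purity: for all `0 < ε' ≤ 1/2`, `B > 0` there are `δ₀ ∈ (0, 1/2)`,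
`η' > 0`, `x₁` such that for `x ≥ x₁` all `m ∈ (M, 2M]` outside a set `I` with `#I ≤ x^{1−ε'−η'}`
satisfy `E♯(x; m) < x/(φ(m) L^B)`.

Proof.  Take `δ₀, k, η, x₀` from the hypothesis at the same `ε'`, answer with `δ₀`, `η' = η/2`
and `x₁ = max x₀ X`.  At height `x` let `Bad` be the set of `m ∈ (M, 2M] \ E` with
`x/(φ(m) L^B) ≤ E♯(x; m)` and `I = E ∪ Bad`; purity off `I` holds by construction
(`exists_exceptional_set`).  Since `1 ≤ φ(m) ≤ m ≤ 2M` on the window, every bad `m` has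
`E♯(x; m) ≥ T = x/(2M L^B)` (`threshold_le`), so Markov's inequality gives
`#Bad · T^{2k} ≤ ∑_{(M,2M] \ E} E♯^{2k} ≤ x^{2k−η}/M^{2k−1}`, i.e.
`#Bad ≤ 4^k · M x^{−η} · L^{2kB} = 4^k x^{1−ε'−η} L^{2kB}` (`moment_div_threshold_pow`).  Hence
`#I ≤ x^{1−ε'−η} (1 + 4^k L^{2kB}) ≤ x^{1−ε'−η} x^{η/2}` for `x ≥ X`
(`eventually_one_add_mul_log_rpow_le`, from `(log x)^r = o(x^s)`).

References: standard (Markov's inequality / dyadic bookkeeping as in H. Davenport, *Multiplicative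
Number Theory*, ch. 28).  Nothing number-theoretic happens in this file: `E♯` enters only through
`0 ≤ E♯`.
-/

open Finset Real Filter Asymptotics

namespace Summit.Parity.GeneralizedHardyLittlewood.Theorems.EH.PurityOfMoment

/-! ### Markov's inequality with an exceptional set -/

/-- Markov's inequality, finitary form with an exceptional set: if `f ≥ 0` on `S`, `0 < T ≤ t` on
`S` and `∑_{S \ E} f^n ≤ R`, then off the set `I = E ∪ {m ∈ S \ E : t m ≤ f m}`, of size
`#I ≤ #E + R/T^n`, one has `f < t`. [folklore] -/
theorem exists_exceptional_set {S E : Finset ℕ} {f t : ℕ → ℝ} {T R : ℝ} {n : ℕ}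
    (hf : ∀ m ∈ S, 0 ≤ f m) (hT : 0 < T) (ht : ∀ m ∈ S, T ≤ t m)
    (hR : ∑ m ∈ S \ E, f m ^ n ≤ R) :
    ∃ I : Finset ℕ, (I.card : ℝ) ≤ E.card + R / T ^ n ∧ ∀ m ∈ S, m ∉ I → f m < t m := by
  classical
  set Bad := (S \ E).filter fun m => t m ≤ f m
  have hsub : Bad ⊆ S \ E := Finset.filter_subset _ _
  refine ⟨E ∪ Bad, ?_, fun m hm hmI => ?_⟩
  · have h1 : (Bad.card : ℝ) * T ^ n ≤ R :=
      calc (Bad.card : ℝ) * T ^ n = ∑ m ∈ Bad, T ^ n := by rw [Finset.sum_const, nsmul_eq_mul]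
        _ ≤ ∑ m ∈ Bad, f m ^ n := Finset.sum_le_sum fun m hm =>
            pow_le_pow_left₀ hT.le
              ((ht m (Finset.mem_sdiff.1 (hsub hm)).1).trans (Finset.mem_filter.1 hm).2) n
        _ ≤ ∑ m ∈ S \ E, f m ^ n := Finset.sum_le_sum_of_subset_of_nonneg hsub fun m hm _ =>
            pow_nonneg (hf m (Finset.mem_sdiff.1 hm).1) n
        _ ≤ R := hR
    have h2 : (Bad.card : ℝ) ≤ R / T ^ n := by rwa [le_div_iff₀ (pow_pos hT n)]
    calc ((E ∪ Bad).card : ℝ) ≤ ((E.card + Bad.card : ℕ) : ℝ) := by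
          exact_mod_cast Finset.card_union_le E Bad
      _ = E.card + Bad.card := by push_cast; ring
      _ ≤ E.card + R / T ^ n := by linarith
  · rw [Finset.mem_union, not_or] at hmI
    by_contra h
    exact hmI.2 (Finset.mem_filter.2 ⟨Finset.mem_sdiff.2 ⟨hm, hmI.1⟩, not_lt.1 h⟩)

/-! ### The threshold on the window and the power bookkeeping -/

/-- On the window `m ∈ (⌊M⌋, ⌊2M⌋]` one has `1 ≤ φ(m) ≤ m ≤ 2M`, hence
`x/(2M P) ≤ x/(φ(m) P)` for `x ≥ 0`, `P > 0`. [folklore] -/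
theorem threshold_le {x M P : ℝ} {m : ℕ} (hx : 0 ≤ x) (hM : 0 ≤ M) (hP : 0 < P)
    (hm : m ∈ Finset.Ioc ⌊M⌋₊ ⌊2 * M⌋₊) :
    x / (2 * M * P) ≤ x / ((Nat.totient m : ℝ) * P) := by
  rw [Finset.mem_Ioc] at hm
  have hm1 : 1 ≤ m := by omega
  have hφ0 : (0 : ℝ) < Nat.totient m := by exact_mod_cast Nat.totient_pos.2 hm1
  have hφ : (Nat.totient m : ℝ) ≤ 2 * M :=
    calc (Nat.totient m : ℝ) ≤ m := by exact_mod_cast Nat.totient_le m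
      _ ≤ ⌊2 * M⌋₊ := by exact_mod_cast hm.2
      _ ≤ 2 * M := Nat.floor_le (by positivity)
  exact div_le_div_of_nonneg_left hx (mul_pos hφ0 hP) (mul_le_mul_of_nonneg_right hφ hP.le)

/-- The power bookkeeping of the Markov step: for `x, M, L > 0`,
`(x^{2k−η} / M^{2k−1}) / (x/(2 M L^B))^{2k} = 4^k · (M x^{−η}) · L^{2kB}`. [folklore] -/
theorem moment_div_threshold_pow {x M L : ℝ} (B η : ℝ) (k : ℕ) (hx : 0 < x) (hM : 0 < M)
    (hL : 0 < L) :
    x ^ (2 * (k : ℝ) - η) / M ^ (2 * (k : ℝ) - 1) / (x / (2 * M * L ^ B)) ^ (2 * k) =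
      4 ^ k * (M * x ^ (-η)) * L ^ (2 * (k : ℝ) * B) := by
  have h2k : (2 * (k : ℝ)) = ((2 * k : ℕ) : ℝ) := by push_cast; ring
  have hx2k : x ^ (2 * (k : ℝ) - η) = x ^ (2 * k) * x ^ (-η) := by
    rw [sub_eq_add_neg, Real.rpow_add hx, h2k, Real.rpow_natCast]
  have hM2k : M ^ (2 * (k : ℝ) - 1) = M ^ (2 * k) / M := by
    rw [Real.rpow_sub hM, Real.rpow_one, h2k, Real.rpow_natCast]
  have hL2k : L ^ (2 * (k : ℝ) * B) = (L ^ B) ^ (2 * k) := by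
    rw [← Real.rpow_natCast (L ^ B) (2 * k), ← Real.rpow_mul hL.le]
    congr 1
    push_cast
    ring
  have h4 : (4 : ℝ) ^ k = 2 ^ (2 * k) := by rw [pow_mul]; norm_num
  have hLB : L ^ B ≠ 0 := (Real.rpow_pos_of_pos hL B).ne'
  have hxη : x ^ (-η) ≠ 0 := (Real.rpow_pos_of_pos hx _).ne'
  rw [hx2k, hM2k, hL2k, h4, div_pow, mul_pow, mul_pow]
  field_simp

/-! ### The eventual absorption of the logarithms -/

/-- For `s > 0`: eventually `2 ≤ x` and `1 + 4^k (log x)^{2kB} ≤ x^s`, from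
`(log x)^{2kB} = o(x^s)` (`isLittleO_log_rpow_rpow_atTop`) and `x^s → ∞`. [folklore] -/
theorem eventually_one_add_mul_log_rpow_le (k : ℕ) (B : ℝ) {s : ℝ} (hs : 0 < s) :
    ∀ᶠ x : ℝ in atTop, 2 ≤ x ∧ 1 + 4 ^ k * Real.log x ^ (2 * (k : ℝ) * B) ≤ x ^ s := by
  filter_upwards [((isLittleO_log_rpow_rpow_atTop (2 * (k : ℝ) * B) hs).const_mul_left
      ((4 : ℝ) ^ k)).def one_half_pos, eventually_ge_atTop (2 : ℝ),
    (tendsto_rpow_atTop hs).eventually_ge_atTop (2 : ℝ)] with x hx hx2 hxs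
  have hL : 0 ≤ Real.log x ^ (2 * (k : ℝ) * B) :=
    Real.rpow_nonneg (Real.log_nonneg (by linarith)) _
  rw [Real.norm_of_nonneg (mul_nonneg (pow_nonneg (by norm_num) k) hL),
    Real.norm_of_nonneg (Real.rpow_nonneg (by linarith) _)] at hx
  exact ⟨hx2, by linarith⟩

/-! ### The stub -/

/-- **Top-window purity from the window moment bound** (stub `stub_purity_of_windowMoment` of the
line `upward-replication-free-factorability`; Markov's inequality): if for every window exponent
`0 < ε' ≤ 1/2` the `2k`-th moment of the maximal conductor-excised discrepancy `E♯(x; m)` over the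
window `m ∈ (x^{1−ε'}, 2x^{1−ε'}]`, outside an exceptional set of size `≤ x^{1−ε'−η}`, is
`≤ x^{2k−η}/(x^{1−ε'})^{2k−1}`, then for every `0 < ε' ≤ 1/2` and `B > 0` all moduli of the window
outside a set of size `≤ x^{1−ε'−η/2}` satisfy `E♯(x; m) < x/(φ(m)(log x)^B)` (`x` large): the
impure moduli `m` have `E♯(x; m) ≥ x/(2x^{1−ε'}(log x)^B)`, so there are at most
`4^k x^{1−ε'−η}(log x)^{2kB} ≤ x^{1−ε'−η}(x^{η/2} − 1)` of them outside the exceptional set.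
[folklore] -/
theorem stub_purity_of_windowMoment :
    (∀ ε' : ℝ, 0 < ε' → ε' ≤ 1 / 2 →
      ∃ δ₀ : ℝ, 0 < δ₀ ∧ δ₀ < 1 / 2 ∧ ∃ k : ℕ, ∃ η : ℝ, 0 < η ∧ ∃ x₀ : ℝ, ∀ x : ℝ, x₀ ≤ x →
        ∃ E : Finset ℕ, (E.card : ℝ) ≤ x ^ (1 - ε' - η) ∧
          ∑ m ∈ (Finset.Ioc ⌊x ^ (1 - ε')⌋₊ ⌊2 * x ^ (1 - ε')⌋₊ \ E),
              (⨆ a : (ZMod m)ˣ,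
                  ‖((Nat.totient m : ℂ))⁻¹ *
                      ∑ χ ∈ (Finset.univ : Finset (DirichletCharacter ℂ m)) with
                          ⌊x ^ (1 / 2 - δ₀)⌋₊ < χ.conductor,
                        χ (a : ZMod m)⁻¹ * Literature.NumberTheory.Sieve.chebyshevPsiChar χ x‖) ^ (2 * k) ≤
            x ^ (2 * (k : ℝ) - η) / (x ^ (1 - ε')) ^ (2 * (k : ℝ) - 1)) →
    ∀ ε' : ℝ, 0 < ε' → ε' ≤ 1 / 2 → ∀ B : ℝ, 0 < B →
      ∃ δ₀ : ℝ, 0 < δ₀ ∧ δ₀ < 1 / 2 ∧ ∃ η : ℝ, 0 < η ∧ ∃ x₀ : ℝ, ∀ x : ℝ, x₀ ≤ x →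
        ∃ I : Finset ℕ, (I.card : ℝ) ≤ x ^ (1 - ε' - η) ∧
          ∀ m ∈ Finset.Ioc ⌊x ^ (1 - ε')⌋₊ ⌊2 * x ^ (1 - ε')⌋₊, m ∉ I →
            (⨆ a : (ZMod m)ˣ,
                ‖((Nat.totient m : ℂ))⁻¹ *
                    ∑ χ ∈ (Finset.univ : Finset (DirichletCharacter ℂ m)) with
                        ⌊x ^ (1 / 2 - δ₀)⌋₊ < χ.conductor,
                      χ (a : ZMod m)⁻¹ * Literature.NumberTheory.Sieve.chebyshevPsiChar χ x‖) <
              x / ((Nat.totient m : ℝ) * Real.log x ^ B) := by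
  intro hMom ε' hε' hε'' B _
  obtain ⟨δ₀, hδ₀, hδ₀', k, η, hη, x₀, hx₀⟩ := hMom ε' hε' hε''
  obtain ⟨X, hX⟩ := Filter.eventually_atTop.1
    (eventually_one_add_mul_log_rpow_le k B (half_pos hη))
  refine ⟨δ₀, hδ₀, hδ₀', η / 2, half_pos hη, max x₀ X, fun x hx => ?_⟩
  obtain ⟨hx2, hev⟩ := hX x ((le_max_right _ _).trans hx)
  obtain ⟨E, hE, hsum⟩ := hx₀ x ((le_max_left _ _).trans hx)
  have hx0 : 0 < x := by linarith
  have hL : 0 < Real.log x := Real.log_pos (by linarith)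
  have hM : 0 < x ^ (1 - ε') := Real.rpow_pos_of_pos hx0 _
  have hLB : 0 < Real.log x ^ B := Real.rpow_pos_of_pos hL _
  have hT : 0 < x / (2 * x ^ (1 - ε') * Real.log x ^ B) :=
    div_pos hx0 (mul_pos (mul_pos two_pos hM) hLB)
  obtain ⟨I, hI, hpure⟩ := exists_exceptional_set
    (S := Finset.Ioc ⌊x ^ (1 - ε')⌋₊ ⌊2 * x ^ (1 - ε')⌋₊) (E := E)
    (f := fun m => ⨆ a : (ZMod m)ˣ,
      ‖((Nat.totient m : ℂ))⁻¹ *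
          ∑ χ ∈ (Finset.univ : Finset (DirichletCharacter ℂ m)) with
              ⌊x ^ (1 / 2 - δ₀)⌋₊ < χ.conductor,
            χ (a : ZMod m)⁻¹ * Literature.NumberTheory.Sieve.chebyshevPsiChar χ x‖)
    (t := fun m => x / ((Nat.totient m : ℝ) * Real.log x ^ B))
    (T := x / (2 * x ^ (1 - ε') * Real.log x ^ B))
    (R := x ^ (2 * (k : ℝ) - η) / (x ^ (1 - ε')) ^ (2 * (k : ℝ) - 1)) (n := 2 * k)
    (fun m _ => Real.iSup_nonneg fun a => norm_nonneg _) hT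
    (fun m hm => threshold_le hx0.le hM.le hLB hm) hsum
  refine ⟨I, hI.trans ?_, hpure⟩
  rw [moment_div_threshold_pow B η k hx0 hM hL, ← Real.rpow_add hx0, ← sub_eq_add_neg]
  have hxe : 0 ≤ x ^ (1 - ε' - η) := Real.rpow_nonneg hx0.le _
  calc (E.card : ℝ) + 4 ^ k * x ^ (1 - ε' - η) * Real.log x ^ (2 * (k : ℝ) * B)
      ≤ x ^ (1 - ε' - η) + 4 ^ k * x ^ (1 - ε' - η) * Real.log x ^ (2 * (k : ℝ) * B) := by
        gcongr
    _ = x ^ (1 - ε' - η) * (1 + 4 ^ k * Real.log x ^ (2 * (k : ℝ) * B)) := by ring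
    _ ≤ x ^ (1 - ε' - η) * x ^ (η / 2) := by gcongr
    _ = x ^ (1 - ε' - η / 2) := by
        rw [← Real.rpow_add hx0]
        congr 1
        ring

end Summit.Parity.GeneralizedHardyLittlewood.Theorems.EH.PurityOfMoment
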